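import Mathlib
import Literature.NumberTheory.LFunctions.FeketePolynomial
import Literature.RingTheory.Valuation.AlgClosedResidue
import Literature.RingTheory.Valuation.RootReduction
import Summits.ValiantsHypothesis.ValiantsHypothesis.Theses.FeketeSOS
import Summits.ValiantsHypothesis.ValiantsHypothesis.Theorems.FeketeSOSDepthZeroShadow
import Summits.ValiantsHypothesis.ValiantsHypothesis.Theorems.FeketeSOSSublinearShadowTrivialShadow
import Summits.ValiantsHypothesis.ValiantsHypothesis.Theorems.FeketeSOSSublinearShadowThreeSquares
import Summits.ValiantsHypothesis.ValiantsHypothesis.Theorems.FeketeSOSSublinearShadowAlgebraicRep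
import Summits.ValiantsHypothesis.ValiantsHypothesis.Theorems.FeketeSOSSublinearShadowGramWindowShadow
import Summits.ValiantsHypothesis.ValiantsHypothesis.Theorems.FeketeSOSSublinearShadowWindowCoreReduction
import Summits.ValiantsHypothesis.ValiantsHypothesis.Theorems.FeketeSOSSublinearShadowIsotropicLift
import Summits.ValiantsHypothesis.ValiantsHypothesis.Theorems.FeketeSOSSublinearShadowCharPFewnomialAnyDegree
import Summits.ValiantsHypothesis.ValiantsHypothesis.Theorems.FeketeSOSSublinearShadowCyclicSqrt

/-!
# Skeleton (reshape 9, continuation lead c11, 2026-08-17T11:40Z) — crux `FeketeSOS.SublinearShadow` (stmt-ValiantsHypothesis-14990), line `Sketch`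

Reshape 9 = reshape 8 UNCHANGED in its composition (`SublinearShadow_of` ⟸ (L) landed + (W6) open, crux-equivalent by p144850) plus the
tool stubs (N2) `stub_cyclicSqrt` / `stub_squareDeterminedByProduct`, REGISTERED (`ledger workitem stub-add`) and LANDED by this lead as
p157772 (`Theorems/FeketeSOSSublinearShadowCyclicSqrt.lean`, imported below): in the cyclic group algebra `K[X]/(X^p − 1)` of characteristic
`p` Frobenius collapses (`G^p ≡ G(1)^p`), so a cyclic square root is EXPLICIT — `X^p − 1 ∣ G² − Φ ⟹ X^p − 1 ∣ G(1)^p·G − Φ^((p+1)/2)` —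
unique up to scalars, and in a product-plus-square identity `A·B + c·G² ≡ T` the square is DETERMINED by the product.  This is the engine of
the lead's `s = 3` census (kit j025656/j025657: restricted-pattern minima of cyclic char-`p` product+square representations of `F̄_p`) and the
sharpest form of the `s = 3` front of (W6) on the characteristic-`p` side: every shadow with one product and one square of non-zero mass is
`(A, B, (κF̄_p − AB)^((p+1)/2))`.  It does not touch (W6) itself (a characteristic-`p` fact; the unit-deep complex data of (W6) live in
characteristic `0` / `p²` layers where `(1+𝔪)^p ≠ 1`).  Exactly ONE `sorry` remains: (W6) `stub_coreFewNoLift`.  Text of reshape 8 follows.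

# Skeleton (reshape 8, republished by continuation lead c7 with N1 IMPORTED) — crux `FeketeSOS.SublinearShadow` (stmt-ValiantsHypothesis-14990), line `Sketch`

Continuation lead c7 (2026-08-17T08:30Z): composition UNCHANGED; the tool stub (N1) `stub_charPFewnomialAnyDegree` is now imported from its
landed module (p147289) instead of being re-declared with a placeholder `sorry`, so this file has exactly ONE `sorry` — the open,
crux-equivalent residual (W6) `stub_coreFewNoLift`.  Text of reshape 8 follows.


Reshape 8 (lead c6, 2026-08-17) = reshape 7 UNCHANGED in its composition (`SublinearShadow_of` ⟸ (L) landed + (W6) open, crux-equivalent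
by p144850) plus ONE registered tool stub (N1) `stub_charPFewnomialAnyDegree`, LANDED by this lead as p147289 (`Theorems/FeketeSOSSublinearShadowCharPFewnomialAnyDegree.lean`; this published copy keeps the registered statement with a placeholder body because the farm snapshot had not yet built the new module when the seat ended — the lead's folder copy `work/SublinearShadow.lean` imports it instead; re-publish that copy once `lean check` resolves the import) — the char-`p` order-vs-sparsity lever at arbitrary degree
(`ord₁ g mod p ≤ |supp g| − 1`), the form of Hajós's lemma that survives `deg ≤ p²`; see its docstring and `Lines/Sketch-dead.md` (v5) §2(ii)
for where it bites (unit-deep `s = 3` conic data).  Text of reshape 7 follows.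

Reshape 6b (lead c4) left ONE open stub, the algebraic NOWHERE-WINDOWABLE few-squares Pareto-minimal core
(`stub_coreFewNowhereWindow`, crux-equivalent by `sublinearShadow_iff_coreFewNowhereWindow` p142523).  Every transfer landed
by leads 0–c4 reads a representation of `F_p` through a ring map `O → K[T]/(T^{v+1})`, which kills `p`: UNIT-DEEP Gram
data (`θ_𝔭 ≥ e_𝔭` at every place) are invisible to all of them.  RESHAPE 7 adds the first mechanism that starts from
unit-deep data — RE-ASSOCIATION ALONG AN INTEGRAL ISOTROPIC LIFT:

* (L) `stub_isotropicLiftShadow` — if the cleared Gram form `w·F_p = Σ B_{jj'} h_j h_{j'}` (`B ∈ O^{r×r}`, `w ∈ O ∖ 0`, e.g.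
  `w = π^θ` at ANY depth `θ`) admits an integral isotropic lift to full depth, `h_j = H_j + w ρ_j` with `H_j, ρ_j ∈ O[X]` and
  `Σ B_{jj'} H_j H_{j'} = 0`, then `F_p = Σ B_{jj'}(H_j ρ_{j'} + ρ_j H_{j'}) + w Σ B_{jj'} ρ_j ρ_{j'}` is an `O`-INTEGRAL
  quadratic form in `(H, ρ)` — a depth-zero representation manufactured from a unit-deep one — whence a cyclic
  characteristic-`p` shadow with `≤ 8r²` squares and support `≤ 8r² · Σ_j (|supp H_j| + |supp ρ_j|)` (reduce, polarise, fold).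
  At `r = 3`, `B ≃ y₁y₃ − y₂²`, the lift is a cone point `D·(M², MN, N²) ≡ h (mod w)`; modulo `𝔪_O` such a lift always exists
  with the supports of the characteristic-`p` conic parametrisation `h̄ = d·(m², mn, n²)`; the cost is the sparsity of the
  lift, not the depth.
* `SublinearShadow_of` — the crux by name ⟸ the residual (Pareto-minimal representative, algebraic by `stub_algebraicRep`,
  `≥ 3` squares, trivial two-square shadow, Gram-window shadow over a field of definition [c4], cheap isotropic-lift shadow
  [NEW], or the residual; constants `A ↦ A + 4`, `p₁ ↦ max p₁ 257`).  PROVED modulo the stubs.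
* (W6) `stub_coreFewNoLift` — THE OPEN RESIDUAL: reshape 6b's nowhere-windowable core restricted further to representations
  for which EVERY integral isotropic-lift datum `(O, r ≤ s, B, w, H, ρ)` of `F_p` costs more than the budget,
  `Σ_j (|supp H_j| + |supp ρ_j|) > (s+1)^A · S`.  Behind wall W1; crux-equivalent by restriction.
-/

namespace Summit.ValiantsHypothesis.ValiantsHypothesis.Theorems.SublinearShadowSketch

open Polynomial Finset IsLocalRing Matrix
open scoped BigOperators

-- `Summit.ValiantsHypothesis.ValiantsHypothesis.…` is the tree's mandated single-conjunct layout (Sub = Summit).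
set_option linter.dupNamespace false

/-! Landed and imported: (W0) `stub_algebraicRep` (p141746), (W4) `stub_gramWindowShadow` (p142060), (L) `stub_isotropicLiftShadow`
(p143763, `Theorems/FeketeSOSSublinearShadowIsotropicLift.lean`), `stub_threeSquares`, `stub_trivialShadow`, `wcr_rep_descend`,
`wcr_four_mul_sq_le_cube` (p142523).  The composition below with (W6) as a hypothesis is landed as
`sublinearShadow_of_coreFewNoLift` / `sublinearShadow_iff_coreFewNoLift` (`Theorems/FeketeSOSSublinearShadowNoLiftCoreReduction.lean`, p144850). -/

/-- **Stub (W6): THE OPEN RESIDUAL — the nowhere-windowable, non-liftable few-squares Pareto-minimal core.**  For `p` large,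
every complex representation `Σ_{i<s} c_i g_i² = F_p` with `deg g_i ≤ p²`, support-sum `S`, `S⁴ ≤ p³`, `3 ≤ s`, FEW squares
(`(s+1)^A · S < 2p`), PARETO-MINIMAL support-sum among representations with `≤ s` squares, ALGEBRAIC coefficients, whose Gram
matrix is NON-INTEGRAL AGAINST EVERY WINDOW DATUM of order `v + 1 ≤ (s+1)^A` over every field of definition (reshape 6b), and
such that EVERY INTEGRAL ISOTROPIC-LIFT DATUM of `F_p` of rank `r ≤ s` at every valuation subring `O ⊂ ℂ` over `p` —
`B ∈ O^{r×r}`, `w ∈ O ∖ 0`, `H, ρ ∈ O[X]^r`, `Σ B H H = 0`, `w F_p = Σ B (H + wρ)(H + wρ)` — is EXPENSIVE,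
`Σ_j (|supp H_j| + |supp ρ_j|) > (s+1)^A · S`, has a cyclic characteristic-`p` shadow with `≤ (s+1)^A` weighted squares of
degree `< p` and total support `≤ (s+1)^A · S`.  (Unit-deep or over-ramified everywhere AND no sparse isotropic lift anywhere;
not refutable by small models — wall W1; crux-equivalent by restriction.) -/
theorem stub_coreFewNoLift :
    ∃ A p₁ : ℕ, ∀ (p : ℕ) [Fact p.Prime], p₁ ≤ p → ∀ (s : ℕ) (c : Fin s → ℂ) (g : Fin s → Polynomial ℂ),
      (∀ i, IsAlgebraic ℚ (c i)) → (∀ i n, IsAlgebraic ℚ ((g i).coeff n)) →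
      (∀ i, (g i).natDegree ≤ p ^ 2) → (∑ i, (g i).support.card) ^ 4 ≤ p ^ 3 →
      (∑ i, Polynomial.C (c i) * g i ^ 2)
        = ∑ m ∈ Finset.range p, Polynomial.C ((legendreSym p m : ℤ) : ℂ) * Polynomial.X ^ m →
      3 ≤ s → (s + 1) ^ A * (∑ i, (g i).support.card) < 2 * p →
      (∀ (s' : ℕ) (c' : Fin s' → ℂ) (g' : Fin s' → Polynomial ℂ), s' ≤ s →
        (∀ i, (g' i).natDegree ≤ p ^ 2) →
        (∑ i, Polynomial.C (c' i) * g' i ^ 2)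
          = ∑ m ∈ Finset.range p, Polynomial.C ((legendreSym p m : ℤ) : ℂ) * Polynomial.X ^ m →
        (∑ i, (g i).support.card) ≤ ∑ i, (g' i).support.card) →
      (∀ (F : Type) [Field F] (ι : F →+* ℂ) (cF : Fin s → F) (gF : Fin s → Polynomial F),
        (∀ i, ι (cF i) = c i) → (∀ i, (gF i).map ι = g i) →
        ∀ (O : ValuationSubring F), ((p : ℕ) : O) ∈ maximalIdeal O →
        ∀ (K : Type) [Field K] [CharP K p] (v : ℕ) (ψ : O →+* AdjoinRoot ((X : K[X]) ^ (v + 1))) (w : O) (θ : ℕ),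
        v + 1 ≤ (s + 1) ^ A → ψ (w ^ θ) ≠ 0 →
        ∃ a b : ℕ, (w : F) ^ θ * (∑ i, cF i * (gF i).coeff a * (gF i).coeff b) ∉ O) →
      (∀ (O : ValuationSubring ℂ), ((p : ℕ) : O) ∈ maximalIdeal O →
        ∀ (r : ℕ) (B : Fin r → Fin r → ℂ) (w : ℂ) (H ρ : Fin r → Polynomial ℂ), r ≤ s →
        (∀ j j', B j j' ∈ O) → w ∈ O → w ≠ 0 →
        (∀ j n, (H j).coeff n ∈ O) → (∀ j n, (ρ j).coeff n ∈ O) →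
        (∑ j, ∑ j', Polynomial.C (B j j') * (H j * H j')) = 0 →
        Polynomial.C w * (∑ m ∈ Finset.range p, Polynomial.C ((legendreSym p m : ℤ) : ℂ) * Polynomial.X ^ m)
          = ∑ j, ∑ j', Polynomial.C (B j j') * ((H j + Polynomial.C w * ρ j) * (H j' + Polynomial.C w * ρ j')) →
        (s + 1) ^ A * (∑ i, (g i).support.card) < ∑ j, ((H j).support.card + (ρ j).support.card)) →
      ∃ (K : Type) (_ : Field K) (_ : CharP K p) (d : ℕ) (c' : Fin d → K) (g' : Fin d → Polynomial K),
        d ≤ (s + 1) ^ A ∧ (∀ j, (g' j).natDegree < p) ∧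
        (∑ j, (g' j).support.card) ≤ (s + 1) ^ A * ∑ i, (g i).support.card ∧
        ((Polynomial.X : Polynomial K) ^ p - 1 ∣ (∑ j, Polynomial.C (c' j) * g' j ^ 2)
          - ∑ m ∈ Finset.range p, Polynomial.C ((legendreSym p m : ℤ) : K) * Polynomial.X ^ m) := by
  sorry

/-! (N1) `stub_charPFewnomialAnyDegree` — the characteristic-`p` fewnomial lever at ARBITRARY degree
(`ord₁ g mod p + 1 ≤ |supp g|`) — is LANDED (p147289) and now IMPORTED from
`Theorems/FeketeSOSSublinearShadowCharPFewnomialAnyDegree.lean` (same namespace, same name); the reshape-8 placeholder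
declaration is gone (continuation lead c7, 2026-08-17). -/


/-- `8 s² ≤ (s+1)^4`. -/
theorem ncl_eight_mul_sq_le_fourth (s : ℕ) : 8 * (s * s) ≤ (s + 1) ^ 4 := by
  have h3 : 4 * (s * s) ≤ (s + 1) ^ 3 := wcr_four_mul_sq_le_cube s
  have : (s + 1) ^ 4 = (s + 1) ^ 3 * (s + 1) := pow_succ _ _
  rw [this]
  rcases Nat.eq_zero_or_pos s with rfl | hs
  · simp
  · calc 8 * (s * s) = 4 * (s * s) * 2 := by ring
      _ ≤ (s + 1) ^ 3 * (s + 1) := Nat.mul_le_mul h3 (by omega)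

/-- **The crux by name ⟸ the non-liftable nowhere-windowable core** (composition, proved modulo the stubs; constants
`A ↦ A + 4`, `p₁ ↦ max p₁ 257`): Pareto-minimal representative by `Nat.find`, made algebraic by `stub_algebraicRep`
(minimality keeps its support-sum), `≥ 3` squares by `stub_threeSquares`, the trivial two-square shadow (`stub_trivialShadow`)
when `2p ≤ (s₀+1)^A·S₀`; otherwise a window datum of order `v + 1 ≤ (s₀+1)^A` over some field of definition seeing an integral
Gram matrix (`stub_gramWindowShadow`, c4), or a cheap integral isotropic-lift datum (`stub_isotropicLiftShadow`, NEW: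
`d ≤ 8s₀² ≤ (s+1)^4`, support `≤ 8s₀²·(s₀+1)^A·S₀`), or the residual `stub_coreFewNoLift`; monotonicity. -/
theorem SublinearShadow_of :
    Summit.ValiantsHypothesis.ValiantsHypothesis.Theses.FeketeSOS.SublinearShadow := by
  obtain ⟨A, p₁, HW⟩ := stub_coreFewNoLift
  unfold Summit.ValiantsHypothesis.ValiantsHypothesis.Theses.FeketeSOS.SublinearShadow
  refine ⟨A + 4, max p₁ 257, ?_⟩
  intro p _ hp s c g hdeg hS hrep
  classical
  have hprime : p.Prime := Fact.out
  have hp₁ : p₁ ≤ p := le_trans (le_max_left _ _) hp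
  have hp257 : 257 ≤ p := le_trans (le_max_right _ _) hp
  have hp2 : p ≠ 2 := by omega
  -- Step 0: a Pareto-minimal representation below `(s, c, g)`
  set Srep : ℕ := ∑ i, (g i).support.card with hSrep
  have hex : ∃ n, ∃ (s' : ℕ) (c' : Fin s' → ℂ) (g' : Fin s' → Polynomial ℂ), s' ≤ s ∧
      (∀ i, (g' i).natDegree ≤ p ^ 2) ∧
      (∑ i, Polynomial.C (c' i) * g' i ^ 2)
        = ∑ m ∈ Finset.range p, Polynomial.C ((legendreSym p m : ℤ) : ℂ) * Polynomial.X ^ m ∧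
      (∑ i, (g' i).support.card) = n := ⟨Srep, s, c, g, le_rfl, hdeg, hrep, rfl⟩
  obtain ⟨s₀, c₀, g₀, hs₀, hdeg₀, hrep₀, hS₀⟩ := Nat.find_spec hex
  have hmin₀ : ∀ (s' : ℕ) (c' : Fin s' → ℂ) (g' : Fin s' → Polynomial ℂ), s' ≤ s →
      (∀ i, (g' i).natDegree ≤ p ^ 2) →
      (∑ i, Polynomial.C (c' i) * g' i ^ 2)
        = ∑ m ∈ Finset.range p, Polynomial.C ((legendreSym p m : ℤ) : ℂ) * Polynomial.X ^ m →
      Nat.find hex ≤ ∑ i, (g' i).support.card :=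
    fun s' c' g' hs' hdeg' hrep' => Nat.find_min' hex ⟨s', c', g', hs', hdeg', hrep', rfl⟩
  set S₀ : ℕ := ∑ i, (g₀ i).support.card with hS₀def
  have hS₀le : S₀ ≤ Srep := by rw [hS₀]; exact hmin₀ s c g le_rfl hdeg hrep
  have hS₀4 : S₀ ^ 4 ≤ p ^ 3 := le_trans (Nat.pow_le_pow_left hS₀le 4) hS
  -- Step 0': an ALGEBRAIC representative with the same number of squares and no larger supports (`stub_algebraicRep`);
  -- by minimality its support-sum is again `S₀`
  obtain ⟨c₁, g₁, halgc, halgg, hsub, hrep₁⟩ := stub_algebraicRep p s₀ c₀ g₀ hrep₀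
  have hdeg₁ : ∀ i, (g₁ i).natDegree ≤ p ^ 2 := fun i => by
    rw [Polynomial.natDegree_le_iff_coeff_eq_zero]
    intro m hm
    have hm₀ : m ∉ (g₀ i).support :=
      notMem_support_iff.mpr (coeff_eq_zero_of_natDegree_lt (lt_of_le_of_lt (hdeg₀ i) hm))
    exact notMem_support_iff.mp fun hm₁ => hm₀ (hsub i hm₁)
  set S₁ : ℕ := ∑ i, (g₁ i).support.card with hS₁def
  have hS₁le : S₁ ≤ S₀ := Finset.sum_le_sum fun i _ => Finset.card_le_card (hsub i)
  have hS₁ge : S₀ ≤ S₁ := by rw [hS₀]; exact hmin₀ s₀ c₁ g₁ hs₀ hdeg₁ hrep₁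
  have hS₁eq : S₁ = S₀ := le_antisymm hS₁le hS₁ge
  have hS₁4 : S₁ ^ 4 ≤ p ^ 3 := hS₁eq ▸ hS₀4
  have hmin : ∀ (s' : ℕ) (c' : Fin s' → ℂ) (g' : Fin s' → Polynomial ℂ), s' ≤ s₀ →
      (∀ i, (g' i).natDegree ≤ p ^ 2) →
      (∑ i, Polynomial.C (c' i) * g' i ^ 2)
        = ∑ m ∈ Finset.range p, Polynomial.C ((legendreSym p m : ℤ) : ℂ) * Polynomial.X ^ m →
      S₁ ≤ ∑ i, (g' i).support.card := fun s' c' g' hs' hdeg' hrep' => by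
    rw [hS₁eq, hS₀]; exact hmin₀ s' c' g' (hs'.trans hs₀) hdeg' hrep'
  -- Step 1: at least three squares; budget arithmetic
  have h3 : 3 ≤ s₀ := stub_threeSquares p hp257 s₀ c₀ g₀ hS₀4 hrep₀
  have hs1 : (s₀ + 1) ^ A ≤ (s + 1) ^ A := Nat.pow_le_pow_left (Nat.succ_le_succ hs₀) A
  have hsA : (s + 1) ^ A ≤ (s + 1) ^ (A + 4) := Nat.pow_le_pow_right (Nat.succ_pos s) (Nat.le_add_right A 4)
  have hcube : (s₀ + 1) ^ 3 ≤ (s + 1) ^ 3 := Nat.pow_le_pow_left (Nat.succ_le_succ hs₀) 3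
  have hfour : (s₀ + 1) ^ 4 ≤ (s + 1) ^ 4 := Nat.pow_le_pow_left (Nat.succ_le_succ hs₀) 4
  have hsq : 4 * (s₀ * s₀) ≤ (s + 1) ^ 3 := (wcr_four_mul_sq_le_cube s₀).trans hcube
  have hsq8 : 8 * (s₀ * s₀) ≤ (s + 1) ^ 4 := (ncl_eight_mul_sq_le_fourth s₀).trans hfour
  have h34 : (s + 1) ^ 3 ≤ (s + 1) ^ 4 := Nat.pow_le_pow_right (Nat.succ_pos s) (by norm_num)
  have hpow4 : (s + 1) ^ (A + 4) = (s + 1) ^ A * (s + 1) ^ 4 := pow_add _ _ _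
  have hsq' : 4 * (s₀ * s₀) ≤ (s + 1) ^ (A + 4) := by
    rw [hpow4]
    exact le_mul_of_one_le_of_le (Nat.one_le_pow _ _ (Nat.succ_pos s)) (hsq.trans h34)
  by_cases hmany : 2 * p ≤ (s₀ + 1) ^ A * S₀
  · -- Step 2a: many squares — the trivial two-square shadow over `ZMod p`
    obtain ⟨c', g', hdeg', hcard', hrep'⟩ := stub_trivialShadow p hp2
    refine ⟨ZMod p, inferInstance, inferInstance, 2, c', g', ?_, hdeg', ?_, ?_⟩
    · calc 2 ≤ 4 * (s₀ * s₀) := by nlinarith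
        _ ≤ (s + 1) ^ (A + 4) := hsq'
    · calc ∑ j, (g' j).support.card ≤ 2 * p := hcard'
        _ ≤ (s₀ + 1) ^ A * S₀ := hmany
        _ ≤ (s + 1) ^ (A + 4) * Srep := Nat.mul_le_mul (hs1.trans hsA) hS₀le
    · rw [hrep', sub_self]; exact dvd_zero _
  · push Not at hmany
    have hmany₁ : (s₀ + 1) ^ A * S₁ < 2 * p := by rw [hS₁eq]; exact hmany
    by_cases hdeep : ∀ (F : Type) [Field F] (ι : F →+* ℂ) (cF : Fin s₀ → F) (gF : Fin s₀ → Polynomial F),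
        (∀ i, ι (cF i) = c₁ i) → (∀ i, (gF i).map ι = g₁ i) →
        ∀ (O : ValuationSubring F), ((p : ℕ) : O) ∈ maximalIdeal O →
        ∀ (K : Type) [Field K] [CharP K p] (v : ℕ) (ψ : O →+* AdjoinRoot ((X : K[X]) ^ (v + 1))) (w : O) (θ : ℕ),
        v + 1 ≤ (s₀ + 1) ^ A → ψ (w ^ θ) ≠ 0 →
        ∃ a b : ℕ, (w : F) ^ θ * (∑ i, cF i * (gF i).coeff a * (gF i).coeff b) ∉ O
    · by_cases hlift : ∀ (O : ValuationSubring ℂ), ((p : ℕ) : O) ∈ maximalIdeal O →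
          ∀ (r : ℕ) (B : Fin r → Fin r → ℂ) (w : ℂ) (H ρ : Fin r → Polynomial ℂ), r ≤ s₀ →
          (∀ j j', B j j' ∈ O) → w ∈ O → w ≠ 0 →
          (∀ j n, (H j).coeff n ∈ O) → (∀ j n, (ρ j).coeff n ∈ O) →
          (∑ j, ∑ j', Polynomial.C (B j j') * (H j * H j')) = 0 →
          Polynomial.C w * (∑ m ∈ Finset.range p, Polynomial.C ((legendreSym p m : ℤ) : ℂ) * Polynomial.X ^ m)
            = ∑ j, ∑ j', Polynomial.C (B j j') * ((H j + Polynomial.C w * ρ j) * (H j' + Polynomial.C w * ρ j')) →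
          (s₀ + 1) ^ A * S₁ < ∑ j, ((H j).support.card + (ρ j).support.card)
      · -- Step 2b: nowhere windowable and no cheap isotropic lift — the residual, applied to the algebraic minimal representation
        obtain ⟨K, instF, instC, d, c', g', hd, hdeg', hcard, hdvd⟩ :=
          HW p hp₁ s₀ c₁ g₁ halgc halgg hdeg₁ hS₁4 hrep₁ h3 hmany₁ hmin hdeep hlift
        refine ⟨K, instF, instC, d, c', g', ?_, hdeg', ?_, hdvd⟩
        · exact hd.trans (hs1.trans hsA)
        · calc ∑ j, (g' j).support.card ≤ (s₀ + 1) ^ A * S₁ := hcard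
            _ ≤ (s + 1) ^ (A + 4) * Srep := Nat.mul_le_mul (hs1.trans hsA) (hS₁le.trans hS₀le)
      · -- Step 2c: a cheap integral isotropic-lift datum at some place of `ℂ` over `p` — re-association (NEW)
        push Not at hlift
        obtain ⟨O, hpO, r, B, w, H, ρ, hr, hB, hw, hw0, hH, hρ, hiso, hrepL, hcost⟩ := hlift
        obtain ⟨K', instF', instC', d, c', g', hd, hdeg', hcard, hdvd⟩ :=
          stub_isotropicLiftShadow p hp2 O hpO r B hB w hw hw0 H ρ hH hρ hiso hrepL
        have hr2 : 8 * (r * r) ≤ (s + 1) ^ 4 :=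
          (Nat.mul_le_mul_left 8 (Nat.mul_le_mul hr hr)).trans hsq8
        have hbudget : 8 * (r * r) ≤ (s + 1) ^ (A + 4) := by
          rw [hpow4]
          exact le_mul_of_one_le_of_le (Nat.one_le_pow _ _ (Nat.succ_pos s)) hr2
        refine ⟨K', instF', instC', d, c', g', hd.trans hbudget, hdeg', ?_, hdvd⟩
        calc ∑ j, (g' j).support.card ≤ 8 * (r * r) * ∑ j, ((H j).support.card + (ρ j).support.card) := hcard
          _ ≤ (s + 1) ^ 4 * ((s₀ + 1) ^ A * S₁) := Nat.mul_le_mul hr2 hcost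
          _ = ((s₀ + 1) ^ A * (s + 1) ^ 4) * S₁ := by ring
          _ ≤ ((s + 1) ^ A * (s + 1) ^ 4) * Srep :=
              Nat.mul_le_mul (Nat.mul_le_mul_right _ hs1) (hS₁le.trans hS₀le)
          _ = (s + 1) ^ (A + 4) * Srep := by rw [hpow4]
    · -- Step 2d: some window datum over some field of definition sees an integral Gram matrix — the Gram-window shadow (c4)
      push Not at hdeep
      obtain ⟨F, instF, ι, cF, gF, hc, hg, O, hpO, K, instK, instC, v, ψ, w, θ, hv, hw, hgram⟩ := hdeep
      have hrepF := wcr_rep_descend p hrep₁ ι cF gF hc hg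
      have hsuppF : ∀ i, (gF i).support.card = (g₁ i).support.card := fun i => by
        rw [← hg i, Polynomial.support_map_of_injective _ ι.injective]
      obtain ⟨K', instF', instC', d, c', g', hd, hdeg', hcard, hdvd⟩ :=
        stub_gramWindowShadow p hp2 s₀ cF gF hrepF O hpO K v ψ w θ hw hgram
      have hbudget : (2 * v + 2) * (2 * (s₀ * s₀)) ≤ (s + 1) ^ (A + 4) := by
        calc (2 * v + 2) * (2 * (s₀ * s₀)) = (v + 1) * (4 * (s₀ * s₀)) := by ring
          _ ≤ (s₀ + 1) ^ A * (s + 1) ^ 3 := Nat.mul_le_mul hv hsq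
          _ ≤ (s + 1) ^ A * (s + 1) ^ 4 := Nat.mul_le_mul hs1 h34
          _ = (s + 1) ^ (A + 4) := hpow4.symm
      refine ⟨K', instF', instC', d, c', g', hd.trans hbudget, hdeg', ?_, hdvd⟩
      calc ∑ j, (g' j).support.card ≤ (2 * v + 2) * (2 * (s₀ * s₀)) * ∑ i, (gF i).support.card := hcard
        _ = (2 * v + 2) * (2 * (s₀ * s₀)) * S₁ := by simp only [hsuppF, hS₁def]
        _ ≤ (s + 1) ^ (A + 4) * Srep := Nat.mul_le_mul hbudget (hS₁le.trans hS₀le)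

end Summit.ValiantsHypothesis.ValiantsHypothesis.Theorems.SublinearShadowSketch
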